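import Mathlib
import Literature.Combinatorics.Enumerative.PermPrescribed

/-!
# `DivisionGap.PerCofactorDegreeReduction` (stmt-ValiantsHypothesis-15046), line `Sketch_ideator4`
(idea intrinsic-member-descent), stub `stub_matchingPadding` — part 1/3: counting over tuples of
permutations (agreements, the hypergeometric MGF, exponential Markov, the per-split tail bound)

Helper file for the random-matching-padding stub (`…StubMatchingPadding.lean`, which carries the
full proof outline).  Everything is over `r`-tuples `ω : Fin r → Equiv.Perm (Fin n)`, counted
exactly (`(n!)^r` tuples, `card_tuples`); no probability spaces.

* `card_filter_agree_mul`, `sum_agr_eq`, `two_mul_card_filter_agr_lt`: the number of ordered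
  agreements `#{(i, k ≠ l) : ω k i = ω l i}` summed over all tuples is `#{k ≠ l} · (n!)^r`
  (translating the `l`-th permutation by a constant `c : Fin n` is a bijection of tuples and the
  `n` translates of the event `ω k i = ω l i` partition the tuples), so by Markov fewer than half of
  the tuples have more than `2 r²` agreements.
* `sum_prod_ite_le`: the upper-tail MGF of the hypergeometric count `#{j ∈ T : π j ∈ S}` of a
  uniformly random permutation is at most the binomial one,
  `∑_π ∏_{j ∈ T} (1 + c [π j ∈ S]) ≤ n! (1 + c |S|/n)^{|T|}` (`c ≥ 0`): expand over `W ⊆ T` and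
  use the negative correlation `#{π : π(W) ⊆ S} · n^{|W|} ≤ |S|^{|W|} · n!`
  (tree: `Literature.…PermPrescribed.card_permsAvoiding_mul_le`).
* `card_filter_lt_sum_hits_mul_exp_le`: exponential Markov over tuples — the sum over tuples of
  `e^{t ∑_k hits (ω k)}` is the `r`-th power of the single-permutation MGF (`Fintype.sum_pow`).
* `card_badSplit_mul_le`: for `r ≥ 400`, `n ≥ 2` and a split `(S, T)` with `3|S| ≤ 2n`,
  `|T| = |S| = s`, the tuples whose total hit count `∑_k #{j ∈ T : ω k j ∈ S}` exceeds
  `r (s²/n + n/10)` are at most a `4^{-(n+1)}` fraction of all tuples (`t = 1/8`,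
  `e^{1/8} - 1 - 1/8 ≤ 1/64`, `(1 + c s/n)^s ≤ e^{c s²/n}`, `s²/n ≤ 4n/9`: the exponent is
  `≤ -r n/180 ≤ -(20/9) n ≤ -(n+1) log 4`).
-/

-- `Summit.ValiantsHypothesis.ValiantsHypothesis.…` is the tree's mandated single-conjunct layout
-- (Sub = Summit), so the duplicated namespace component is intended.
set_option linter.dupNamespace false

open scoped NNReal BigOperators
open Finset

namespace Summit.ValiantsHypothesis.ValiantsHypothesis.Theorems.DivisionGap.PerCofactorDegreeReduction.MatchingPadding

variable {n r : ℕ}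

/-! ### Tuples of permutations: agreements -/

/-- Translating the `l`-th permutation by `c` is a bijection of tuples; hence the number of
tuples with `ω k i = ω l i` equals the number with `ω l i = ω k i + c`. [folklore] -/
theorem card_filter_agree_eq_translate [NeZero n] (k l : Fin r) (hkl : k ≠ l) (i c : Fin n) :
    ((Finset.univ : Finset (Fin r → Equiv.Perm (Fin n))).filter fun ω => ω k i = ω l i).card =
      ((Finset.univ : Finset (Fin r → Equiv.Perm (Fin n))).filter
        fun ω => ω l i = ω k i + c).card := by
  let τ : Equiv.Perm (Fin n) := Equiv.addRight c
  let Φ : (Fin r → Equiv.Perm (Fin n)) ≃ (Fin r → Equiv.Perm (Fin n)) :=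
    Equiv.piCongrRight fun k' => if k' = l then Equiv.mulLeft τ else Equiv.refl _
  refine Finset.card_equiv Φ fun ω => ?_
  simp only [Finset.mem_filter, Finset.mem_univ, true_and]
  have hl : Φ ω l = τ * ω l := by
    simp [Φ, Equiv.piCongrRight]
  have hk : Φ ω k = ω k := by
    simp [Φ, Equiv.piCongrRight, hkl]
  rw [hl, hk, Equiv.Perm.mul_apply]
  simp only [τ, Equiv.coe_addRight]
  constructor
  · intro h; rw [h]
  · intro h; exact (add_right_cancel h).symm

/-- `n · #{ω : ω k i = ω l i} = #tuples` for `k ≠ l`. [folklore] -/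
theorem card_filter_agree_mul (k l : Fin r) (hkl : k ≠ l) (i : Fin n) :
    n * ((Finset.univ : Finset (Fin r → Equiv.Perm (Fin n))).filter fun ω => ω k i = ω l i).card =
      Fintype.card (Fin r → Equiv.Perm (Fin n)) := by
  haveI : NeZero n := NeZero.of_pos (Fin.pos i)
  calc n * ((Finset.univ : Finset (Fin r → Equiv.Perm (Fin n))).filter fun ω => ω k i = ω l i).card
      = ∑ c : Fin n, ((Finset.univ : Finset (Fin r → Equiv.Perm (Fin n))).filter
          fun ω => ω l i = ω k i + c).card := by
        rw [Finset.sum_congr rfl fun c _ => (card_filter_agree_eq_translate k l hkl i c).symm,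
          Finset.sum_const, Finset.card_univ, Fintype.card_fin, smul_eq_mul]
    _ = ∑ ω : Fin r → Equiv.Perm (Fin n), ((Finset.univ : Finset (Fin n)).filter
          fun c => ω l i = ω k i + c).card := by
        simp only [Finset.card_filter]
        exact Finset.sum_comm
    _ = ∑ ω : Fin r → Equiv.Perm (Fin n), 1 := by
        refine Finset.sum_congr rfl fun ω _ => ?_
        rw [Finset.card_eq_one]
        refine ⟨ω l i - ω k i, ?_⟩
        ext c
        simp only [Finset.mem_filter, Finset.mem_univ, true_and, Finset.mem_singleton]
        constructor
        · intro h; rw [h]; abel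
        · intro h; rw [h]; abel
    _ = Fintype.card (Fin r → Equiv.Perm (Fin n)) := by simp


/-- The total number of agreements over all tuples is `#{(k,l) : k ≠ l} · #tuples`
(each ordered pair `k ≠ l` and row `i` contributes `#tuples / n`). [folklore] -/
theorem sum_agr_eq (hn : 0 < n) :
    ∑ ω : Fin r → Equiv.Perm (Fin n),
        (∑ i, (Finset.univ.filter fun p : Fin r × Fin r => p.1 ≠ p.2 ∧ ω p.1 i = ω p.2 i).card) =
      ((Finset.univ : Finset (Fin r × Fin r)).filter fun p => p.1 ≠ p.2).card *
        Fintype.card (Fin r → Equiv.Perm (Fin n)) := by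
  apply Nat.eq_of_mul_eq_mul_left hn
  calc n * ∑ ω : Fin r → Equiv.Perm (Fin n),
          (∑ i, (Finset.univ.filter fun p : Fin r × Fin r => p.1 ≠ p.2 ∧ ω p.1 i = ω p.2 i).card)
      = n * ∑ ω : Fin r → Equiv.Perm (Fin n), ∑ i : Fin n,
          ∑ p ∈ (Finset.univ : Finset (Fin r × Fin r)).filter (fun p => p.1 ≠ p.2),
            (if ω p.1 i = ω p.2 i then 1 else 0) := by
        congr 1
        refine Finset.sum_congr rfl fun ω _ => Finset.sum_congr rfl fun i _ => ?_
        rw [Finset.card_filter, Finset.sum_filter]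
        refine Finset.sum_congr rfl fun p _ => ?_
        by_cases h : p.1 ≠ p.2 <;> simp [h]
    _ = n * ∑ i : Fin n, ∑ p ∈ (Finset.univ : Finset (Fin r × Fin r)).filter (fun p => p.1 ≠ p.2),
          ∑ ω : Fin r → Equiv.Perm (Fin n), (if ω p.1 i = ω p.2 i then 1 else 0) := by
        rw [Finset.sum_comm]
        congr 1
        refine Finset.sum_congr rfl fun i _ => ?_
        rw [Finset.sum_comm]
    _ = ∑ i : Fin n, ∑ p ∈ (Finset.univ : Finset (Fin r × Fin r)).filter (fun p => p.1 ≠ p.2),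
          n * ((Finset.univ : Finset (Fin r → Equiv.Perm (Fin n))).filter
            fun ω => ω p.1 i = ω p.2 i).card := by
        rw [Finset.mul_sum]
        refine Finset.sum_congr rfl fun i _ => ?_
        rw [Finset.mul_sum]
        refine Finset.sum_congr rfl fun p _ => ?_
        rw [Finset.card_filter]
    _ = ∑ i : Fin n, ∑ p ∈ (Finset.univ : Finset (Fin r × Fin r)).filter (fun p => p.1 ≠ p.2),
          Fintype.card (Fin r → Equiv.Perm (Fin n)) := by
        refine Finset.sum_congr rfl fun i _ => Finset.sum_congr rfl fun p hp => ?_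
        exact card_filter_agree_mul p.1 p.2 (Finset.mem_filter.mp hp).2 i
    _ = n * (((Finset.univ : Finset (Fin r × Fin r)).filter fun p => p.1 ≠ p.2).card *
          Fintype.card (Fin r → Equiv.Perm (Fin n))) := by
        simp only [Finset.sum_const, Finset.card_univ, Fintype.card_fin, smul_eq_mul]

/-- Markov's inequality in counting form: `#{a : B < f a} · (B + 1) ≤ ∑_a f a`. [folklore] -/
theorem card_filter_lt_mul_le {α : Type*} [Fintype α] (f : α → ℕ) (B : ℕ) :
    ((Finset.univ : Finset α).filter fun a => B < f a).card * (B + 1) ≤ ∑ a, f a := by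
  calc ((Finset.univ : Finset α).filter fun a => B < f a).card * (B + 1)
      = ∑ a ∈ (Finset.univ : Finset α).filter (fun a => B < f a), (B + 1) := by
        rw [Finset.sum_const, smul_eq_mul]
    _ ≤ ∑ a ∈ (Finset.univ : Finset α).filter (fun a => B < f a), f a :=
        Finset.sum_le_sum fun a ha => (Finset.mem_filter.mp ha).2
    _ ≤ ∑ a, f a :=
        Finset.sum_le_sum_of_subset_of_nonneg (Finset.subset_univ _) fun _ _ _ => Nat.zero_le _

/-- Markov's inequality for agreements: fewer than half of all tuples have more than `2 r²`
agreements. [folklore] -/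
theorem two_mul_card_filter_agr_lt :
    2 * ((Finset.univ : Finset (Fin r → Equiv.Perm (Fin n))).filter
        fun ω => 2 * r ^ 2 <
          (∑ i, (Finset.univ.filter
            fun p : Fin r × Fin r => p.1 ≠ p.2 ∧ ω p.1 i = ω p.2 i).card)).card <
      Fintype.card (Fin r → Equiv.Perm (Fin n)) := by
  have hΩ : 0 < Fintype.card (Fin r → Equiv.Perm (Fin n)) := Fintype.card_pos
  rcases Nat.eq_zero_or_pos n with hn | hn
  · subst hn
    have : ((Finset.univ : Finset (Fin r → Equiv.Perm (Fin 0))).filter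
        fun ω => 2 * r ^ 2 <
          (∑ i, (Finset.univ.filter
            fun p : Fin r × Fin r => p.1 ≠ p.2 ∧ ω p.1 i = ω p.2 i).card)) = ∅ := by
      apply Finset.filter_eq_empty_iff.mpr
      intro ω _
      simp
    rw [this]
    simp
  have h1 : ((Finset.univ : Finset (Fin r → Equiv.Perm (Fin n))).filter
        fun ω => 2 * r ^ 2 <
          (∑ i, (Finset.univ.filter
            fun p : Fin r × Fin r => p.1 ≠ p.2 ∧ ω p.1 i = ω p.2 i).card)).card * (2 * r ^ 2 + 1) ≤
      ∑ ω : Fin r → Equiv.Perm (Fin n),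
        (∑ i, (Finset.univ.filter fun p : Fin r × Fin r => p.1 ≠ p.2 ∧ ω p.1 i = ω p.2 i).card) :=
    card_filter_lt_mul_le (fun ω : Fin r → Equiv.Perm (Fin n) =>
      (∑ i, (Finset.univ.filter
        fun p : Fin r × Fin r => p.1 ≠ p.2 ∧ ω p.1 i = ω p.2 i).card)) (2 * r ^ 2)
  have h2 : ∑ ω : Fin r → Equiv.Perm (Fin n),
      (∑ i, (Finset.univ.filter fun p : Fin r × Fin r => p.1 ≠ p.2 ∧ ω p.1 i = ω p.2 i).card) ≤
      r ^ 2 * Fintype.card (Fin r → Equiv.Perm (Fin n)) := by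
    rw [sum_agr_eq hn]
    gcongr
    calc ((Finset.univ : Finset (Fin r × Fin r)).filter fun p => p.1 ≠ p.2).card
        ≤ (Finset.univ : Finset (Fin r × Fin r)).card := Finset.card_filter_le _ _
      _ = r ^ 2 := by simp [sq]
  have h3 := h1.trans h2
  by_contra hcon
  push Not at hcon
  nlinarith [h3, hcon, hΩ]

/-! ### The hypergeometric moment generating function (upper tail) -/

/-- `#{π : π(W) ⊆ S} · n^{|W|} ≤ |S|^{|W|} · n!` (the events `π j ∈ S`, `j ∈ W`, are negatively
correlated). [folklore] -/
theorem card_filter_mapsInto_mul_le (W S : Finset (Fin n)) :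
    ((Finset.univ : Finset (Equiv.Perm (Fin n))).filter fun π => ∀ j ∈ W, π j ∈ S).card *
        n ^ W.card ≤ S.card ^ W.card * n.factorial := by
  have h := Literature.Combinatorics.Enumerative.card_permsAvoiding_mul_le W Sᶜ
  have hset : Literature.Combinatorics.Enumerative.permsAvoiding W Sᶜ =
      (Finset.univ : Finset (Equiv.Perm (Fin n))).filter fun π => ∀ j ∈ W, π j ∈ S := by
    ext π
    simp [Literature.Combinatorics.Enumerative.mem_permsAvoiding]
  have hS : S.card ≤ n := S.card_le_univ.trans_eq (by simp)
  rw [hset, Finset.card_compl, Fintype.card_fin, Nat.sub_sub_self hS] at h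
  exact h

/-- Real form of `card_filter_mapsInto_mul_le`: `#{π : π(W) ⊆ S} ≤ (|S|/n)^{|W|} · n!`.
[folklore] -/
theorem card_filter_mapsInto_le (hn : 0 < n) (W S : Finset (Fin n)) :
    (((Finset.univ : Finset (Equiv.Perm (Fin n))).filter fun π => ∀ j ∈ W, π j ∈ S).card : ℝ) ≤
      ((S.card : ℝ) / n) ^ W.card * n.factorial := by
  have h := card_filter_mapsInto_mul_le W S
  have hn' : (0 : ℝ) < (n : ℝ) ^ W.card := by positivity
  rw [div_pow, div_mul_eq_mul_div, le_div_iff₀ hn']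
  exact_mod_cast h

/-- **Upper-tail MGF of the hypergeometric count.**  For `c ≥ 0`,
`∑_π ∏_{j ∈ T} (1 + c·[π j ∈ S]) ≤ n! · (1 + c |S| / n)^{|T|}`: expand the product over subsets
`W ⊆ T` and use `#{π : π(W) ⊆ S} ≤ (|S|/n)^{|W|} n!`. [folklore] -/
theorem sum_prod_ite_le (hn : 0 < n) (S T : Finset (Fin n)) {c : ℝ} (hc : 0 ≤ c) :
    ∑ π : Equiv.Perm (Fin n), ∏ j ∈ T, (if π j ∈ S then 1 + c else 1) ≤
      n.factorial * (1 + c * S.card / n) ^ T.card := by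
  calc ∑ π : Equiv.Perm (Fin n), ∏ j ∈ T, (if π j ∈ S then 1 + c else 1)
      = ∑ π : Equiv.Perm (Fin n), ∏ j ∈ T, (1 + (if π j ∈ S then c else 0)) := by
        refine Finset.sum_congr rfl fun π _ => Finset.prod_congr rfl fun j _ => ?_
        split_ifs <;> simp
    _ = ∑ π : Equiv.Perm (Fin n), ∑ W ∈ T.powerset, ∏ j ∈ W, (if π j ∈ S then c else 0) := by
        refine Finset.sum_congr rfl fun π _ => ?_
        rw [Finset.prod_one_add]
    _ = ∑ W ∈ T.powerset, ∑ π : Equiv.Perm (Fin n), ∏ j ∈ W, (if π j ∈ S then c else 0) :=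
        Finset.sum_comm
    _ = ∑ W ∈ T.powerset, c ^ W.card *
          (((Finset.univ : Finset (Equiv.Perm (Fin n))).filter
            fun π => ∀ j ∈ W, π j ∈ S).card : ℝ) := by
        refine Finset.sum_congr rfl fun W _ => ?_
        rw [Finset.card_filter, Nat.cast_sum, Finset.mul_sum]
        refine Finset.sum_congr rfl fun π _ => ?_
        rw [Finset.prod_ite_zero, Finset.prod_const]
        split_ifs <;> simp
    _ ≤ ∑ W ∈ T.powerset, c ^ W.card * (((S.card : ℝ) / n) ^ W.card * n.factorial) := by
        gcongr with W hW
        exact card_filter_mapsInto_le hn W S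
    _ = n.factorial * ∑ W ∈ T.powerset, (c * S.card / n) ^ W.card * 1 ^ (T.card - W.card) := by
        rw [Finset.mul_sum]
        refine Finset.sum_congr rfl fun W _ => ?_
        rw [one_pow, mul_one, mul_div_assoc, mul_pow]
        ring
    _ = n.factorial * (1 + c * S.card / n) ^ T.card := by
        rw [Finset.sum_pow_mul_eq_add_pow, add_comm]

/-! ### Chernoff bound by counting -/

/-- **Exponential Markov inequality over tuples.**  For `t ≥ 0` and any threshold `B`,
`#{ω : B < ∑_k hits(ω k)} · e^{tB} ≤ (n! · (1 + (e^t - 1)|S|/n)^{|T|})^r`: the sum over tuples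
of `e^{t ∑_k hits}` factors as an `r`-th power of the single-permutation MGF. [folklore] -/
theorem card_filter_lt_sum_hits_mul_exp_le (hn : 0 < n) (S T : Finset (Fin n)) {t : ℝ}
    (ht : 0 ≤ t) (B : ℝ) :
    (((Finset.univ : Finset (Fin r → Equiv.Perm (Fin n))).filter fun ω =>
        B < ∑ k, ((T.filter fun j => ω k j ∈ S).card : ℝ)).card : ℝ) * Real.exp (t * B) ≤
      (n.factorial * (1 + (Real.exp t - 1) * S.card / n) ^ T.card) ^ r := by
  set bad := (Finset.univ : Finset (Fin r → Equiv.Perm (Fin n))).filter fun ω =>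
    B < ∑ k, ((T.filter fun j => ω k j ∈ S).card : ℝ)
  calc (bad.card : ℝ) * Real.exp (t * B) = ∑ ω ∈ bad, Real.exp (t * B) := by
        rw [Finset.sum_const, nsmul_eq_mul]
    _ ≤ ∑ ω ∈ bad, Real.exp (t * ∑ k, ((T.filter fun j => ω k j ∈ S).card : ℝ)) := by
        refine Finset.sum_le_sum fun ω hω => Real.exp_le_exp.mpr ?_
        exact mul_le_mul_of_nonneg_left (le_of_lt (Finset.mem_filter.mp hω).2) ht
    _ ≤ ∑ ω : Fin r → Equiv.Perm (Fin n),
          Real.exp (t * ∑ k, ((T.filter fun j => ω k j ∈ S).card : ℝ)) :=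
        Finset.sum_le_sum_of_subset_of_nonneg (Finset.subset_univ _)
          fun _ _ _ => (Real.exp_pos _).le
    _ = ∑ ω : Fin r → Equiv.Perm (Fin n), ∏ k, Real.exp t ^ (T.filter fun j => ω k j ∈ S).card := by
        refine Finset.sum_congr rfl fun ω _ => ?_
        rw [Finset.mul_sum, Real.exp_sum]
        refine Finset.prod_congr rfl fun k _ => ?_
        rw [← Real.exp_nat_mul, mul_comm]
    _ = (∑ π : Equiv.Perm (Fin n), Real.exp t ^ (T.filter fun j => π j ∈ S).card) ^ r :=
        (Fintype.sum_pow (fun π : Equiv.Perm (Fin n) =>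
          Real.exp t ^ (T.filter fun j => π j ∈ S).card) r).symm
    _ = (∑ π : Equiv.Perm (Fin n), ∏ j ∈ T, (if π j ∈ S then 1 + (Real.exp t - 1) else 1)) ^ r := by
        congr 1
        refine Finset.sum_congr rfl fun π _ => ?_
        rw [Finset.prod_ite, Finset.prod_const, Finset.prod_const_one, mul_one, add_sub_cancel]
    _ ≤ (n.factorial * (1 + (Real.exp t - 1) * S.card / n) ^ T.card) ^ r := by
        have h0 : 0 ≤ Real.exp t - 1 := by linarith [Real.add_one_le_exp t]
        exact pow_le_pow_left₀ (Finset.sum_nonneg fun π _ => Finset.prod_nonneg fun j _ => by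
          split_ifs <;> linarith) (sum_prod_ite_le hn S T h0) r


/-- The number of tuples of permutations of `Fin n` is `(n!)^r`. [folklore] -/
theorem card_tuples : (Fintype.card (Fin r → Equiv.Perm (Fin n)) : ℝ) = (n.factorial : ℝ) ^ r := by
  rw [Fintype.card_fun, Fintype.card_perm, Fintype.card_fin, Fintype.card_fin]
  push_cast
  ring

/-- **Per-split tail bound.**  With `r ≥ 400` permutations, `n ≥ 2` and `3|S| ≤ 2n`, `|T| = |S|`,
the tuples whose total hit count `∑_k #{j ∈ T : ω k j ∈ S}` exceeds `r (|S|²/n + n/10)` are at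
most a `4^{-(n+1)}` fraction of all tuples (exponential Markov with `t = 1/8`,
`e^{1/8} - 1 - 1/8 ≤ 1/64`, `|S|²/n ≤ 4n/9`). [folklore] -/
theorem card_badSplit_mul_le {n r : ℕ} (hr : 400 ≤ r) (hn : 2 ≤ n) (S T : Finset (Fin n))
    (hS : 3 * S.card ≤ 2 * n) (hT : T.card = S.card) :
    ((Finset.univ : Finset (Fin r → Equiv.Perm (Fin n))).filter fun ω =>
        (r : ℝ) * ((S.card : ℝ) ^ 2 / n + n / 10) <
          ∑ k, ((T.filter fun j => ω k j ∈ S).card : ℝ)).card * 4 ^ (n + 1) ≤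
      Fintype.card (Fin r → Equiv.Perm (Fin n)) := by
  have hn0 : 0 < n := by omega
  set s := S.card with hs_def
  set B : ℝ := r * ((s : ℝ) ^ 2 / n + n / 10) with hB
  have key := card_filter_lt_sum_hits_mul_exp_le (r := r) hn0 S T (t := 1 / 8) (by norm_num) B
  rw [hT] at key
  set N : ℕ := ((Finset.univ : Finset (Fin r → Equiv.Perm (Fin n))).filter fun ω =>
        B < ∑ k, ((T.filter fun j => ω k j ∈ S).card : ℝ)).card with hN
  suffices h : (N : ℝ) * 4 ^ (n + 1) ≤ (Fintype.card (Fin r → Equiv.Perm (Fin n)) : ℝ) by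
    exact_mod_cast h
  rw [card_tuples]
  have hc : Real.exp (1 / 8) - 1 ≤ 1 / 8 + (1 / 8) ^ 2 := by
    have h := Real.abs_exp_sub_one_sub_id_le (x := 1 / 8) (by norm_num)
    rw [abs_le] at h
    linarith [h.2]
  have hc0 : 0 ≤ Real.exp (1 / 8) - 1 := by linarith [Real.add_one_le_exp (1 / 8 : ℝ)]
  -- `(1 + c s/n)^s ≤ exp (c s²/n)`
  have h1 : (1 + (Real.exp (1 / 8) - 1) * s / n) ^ s ≤
      Real.exp ((Real.exp (1 / 8) - 1) * (s : ℝ) ^ 2 / n) := by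
    calc (1 + (Real.exp (1 / 8) - 1) * s / n) ^ s
        ≤ (Real.exp ((Real.exp (1 / 8) - 1) * s / n)) ^ s := by
          apply pow_le_pow_left₀ (by positivity)
          linarith [Real.add_one_le_exp ((Real.exp (1 / 8) - 1) * s / n)]
      _ = Real.exp ((Real.exp (1 / 8) - 1) * (s : ℝ) ^ 2 / n) := by
          rw [← Real.exp_nat_mul]
          congr 1
          ring
  have h2 : (N : ℝ) * Real.exp (1 / 8 * B) ≤
      (n.factorial : ℝ) ^ r * Real.exp (r * ((Real.exp (1 / 8) - 1) * (s : ℝ) ^ 2 / n)) := by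
    calc (N : ℝ) * Real.exp (1 / 8 * B) ≤ _ := key
      _ = (n.factorial : ℝ) ^ r * ((1 + (Real.exp (1 / 8) - 1) * s / n) ^ s) ^ r := by
          rw [mul_pow]
      _ ≤ (n.factorial : ℝ) ^ r * (Real.exp ((Real.exp (1 / 8) - 1) * (s : ℝ) ^ 2 / n)) ^ r := by
          gcongr
      _ = _ := by rw [← Real.exp_nat_mul]
  have hs : (s : ℝ) ^ 2 / n ≤ 4 * n / 9 := by
    rw [div_le_iff₀ (by positivity)]
    have : (3 * s : ℝ) ≤ 2 * n := by exact_mod_cast hS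
    nlinarith
  have h3 : (r : ℝ) * ((Real.exp (1 / 8) - 1) * (s : ℝ) ^ 2 / n) - 1 / 8 * B ≤
      -((r : ℝ) * n / 180) := by
    have hsn : 0 ≤ (s : ℝ) ^ 2 / n := by positivity
    have hloc : (Real.exp (1 / 8) - 1) * (s : ℝ) ^ 2 / n - 1 / 8 * ((s : ℝ) ^ 2 / n + n / 10) ≤
        -((n : ℝ) / 180) := by
      have e1 : (Real.exp (1 / 8) - 1) * (s : ℝ) ^ 2 / n ≤
          (1 / 8 + (1 / 8) ^ 2) * ((s : ℝ) ^ 2 / n) := by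
        rw [mul_div_assoc]
        exact mul_le_mul_of_nonneg_right hc hsn
      nlinarith [e1, hs]
    have hr0 : (0 : ℝ) ≤ r := by positivity
    have hmul := mul_le_mul_of_nonneg_left hloc hr0
    rw [hB]
    linarith [hmul]
  have h4 : (N : ℝ) ≤ (n.factorial : ℝ) ^ r * Real.exp (-((r : ℝ) * n / 180)) := by
    have hpos : 0 < Real.exp (1 / 8 * B) := Real.exp_pos _
    rw [← le_div_iff₀ hpos] at h2
    refine h2.trans ?_
    rw [div_le_iff₀ hpos, mul_assoc, ← Real.exp_add]
    gcongr
    linarith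
  have h5 : (4 : ℝ) ^ (n + 1) ≤ Real.exp ((r : ℝ) * n / 180) := by
    have hlog4 : Real.log 4 < 1.3862943616 := by
      have : Real.log 4 = 2 * Real.log 2 := by
        rw [show (4 : ℝ) = 2 ^ 2 by norm_num, Real.log_pow]; norm_num
      rw [this]; linarith [Real.log_two_lt_d9]
    have h4 : (4 : ℝ) ^ (n + 1) = Real.exp ((n + 1 : ℕ) * Real.log 4) := by
      rw [Real.exp_nat_mul, Real.exp_log (by norm_num)]
    rw [h4]
    apply Real.exp_le_exp.mpr
    have hn2 : (2 : ℝ) ≤ n := by exact_mod_cast hn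
    have hr4 : (400 : ℝ) ≤ r := by exact_mod_cast hr
    have hl0 : 0 < Real.log 4 := Real.log_pos (by norm_num)
    push_cast
    nlinarith [mul_nonneg (sub_nonneg.mpr hr4) (by positivity : (0 : ℝ) ≤ n),
      mul_nonneg (sub_nonneg.mpr hlog4.le) (by positivity : (0 : ℝ) ≤ n + 1)]
  calc (N : ℝ) * 4 ^ (n + 1)
      ≤ (n.factorial : ℝ) ^ r * Real.exp (-((r : ℝ) * n / 180)) * Real.exp ((r : ℝ) * n / 180) := by
          gcongr
    _ = (n.factorial : ℝ) ^ r := by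
        rw [mul_assoc, ← Real.exp_add, neg_add_cancel, Real.exp_zero, mul_one]

end Summit.ValiantsHypothesis.ValiantsHypothesis.Theorems.DivisionGap.PerCofactorDegreeReduction.MatchingPadding
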